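import Mathlib

/-!
# Crux `UniformPhotonSphereChannelsR` (K1R, stmt-FinalStateConjecture-14074), line
# `crum-peeling-recessive-tower` — Theorem A, rung step (A3), part 1/5: majorant toolkit

Scaled-majorant bookkeeping for the coefficient chain (lead c2, crux NOTES `TheoremA` §2): if
`|x_i| ρ^i ≤ X_i` and `|y_j| ρ^j ≤ Y_j` then `|Σ_i x_i y_{n−i}| ρⁿ ≤ Σ_i X_i Y_{n−i}`
(`majorant_sum_mul`); elementary facts about the two-regime weight
`ω_λ(m) = 1/(m(2λ−1+m))`; and the bound `|α_i| ρ^i ≤ 3ρ/i` for the forcing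
`α_i = (1−i)G_i + 2(i−2)G_{i−1}` under the profile hypothesis `|G_i| ρ^i ≤ 2ρ/i²`.
-/

set_option linter.dupNamespace false

noncomputable section

namespace Summit.FinalStateConjecture.FinalStateConjecture.Theorems.CrumPeelingRecessiveTower

open Finset

/-! ### Scaled majorants of finite convolutions -/

/-- **Scaled majorant of a convolution sum.**  If `|x i| ρ^i ≤ X i` and
`|y (n-i)| ρ^(n-i) ≤ Y (n-i)` for all `i ∈ s` (indices `≤ n`), then
`|Σ_{i∈s} x i · y (n−i)| ρⁿ ≤ Σ_{i∈s} X i · Y (n−i)`. -/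
theorem majorant_sum_mul {ρ : ℝ} (hρ : 0 ≤ ρ) {s : Finset ℕ} {n : ℕ} {x y X Y : ℕ → ℝ}
    (hs : ∀ i ∈ s, i ≤ n) (hx : ∀ i ∈ s, |x i| * ρ ^ i ≤ X i)
    (hy : ∀ i ∈ s, |y (n - i)| * ρ ^ (n - i) ≤ Y (n - i)) :
    |∑ i ∈ s, x i * y (n - i)| * ρ ^ n ≤ ∑ i ∈ s, X i * Y (n - i) := by
  have hρn : 0 ≤ ρ ^ n := pow_nonneg hρ n
  calc |∑ i ∈ s, x i * y (n - i)| * ρ ^ n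
      ≤ (∑ i ∈ s, |x i * y (n - i)|) * ρ ^ n :=
        mul_le_mul_of_nonneg_right (abs_sum_le_sum_abs _ _) hρn
    _ = ∑ i ∈ s, |x i * y (n - i)| * ρ ^ n := by rw [Finset.sum_mul]
    _ ≤ ∑ i ∈ s, X i * Y (n - i) := by
        refine Finset.sum_le_sum fun i hi => ?_
        have hin : i + (n - i) = n := Nat.add_sub_cancel' (hs i hi)
        have hsplit : ρ ^ n = ρ ^ i * ρ ^ (n - i) := by rw [← pow_add, hin]
        rw [abs_mul, hsplit]
        have h1 := hx i hi
        have h2 := hy i hi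
        have hx0 : 0 ≤ |x i| * ρ ^ i := mul_nonneg (abs_nonneg _) (pow_nonneg hρ _)
        have hy0 : 0 ≤ |y (n - i)| * ρ ^ (n - i) := mul_nonneg (abs_nonneg _) (pow_nonneg hρ _)
        calc |x i| * |y (n - i)| * (ρ ^ i * ρ ^ (n - i))
            = (|x i| * ρ ^ i) * (|y (n - i)| * ρ ^ (n - i)) := by ring
          _ ≤ X i * Y (n - i) := mul_le_mul h1 h2 hy0 (hx0.trans h1)

/-- Variant with three factors `c i · x i · y (n−i)` where `c i` is an explicit real weight:
`|Σ c i x i y(n−i)| ρⁿ ≤ Σ |c i| X i Y(n−i)`. -/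
theorem majorant_sum_mul₃ {ρ : ℝ} (hρ : 0 ≤ ρ) {s : Finset ℕ} {n : ℕ} {c x y X Y : ℕ → ℝ}
    (hs : ∀ i ∈ s, i ≤ n) (hx : ∀ i ∈ s, |x i| * ρ ^ i ≤ X i)
    (hy : ∀ i ∈ s, |y (n - i)| * ρ ^ (n - i) ≤ Y (n - i)) :
    |∑ i ∈ s, c i * x i * y (n - i)| * ρ ^ n ≤ ∑ i ∈ s, |c i| * X i * Y (n - i) := by
  have h := majorant_sum_mul (s := s) (n := n) (x := fun i => c i * x i) (y := y)
    (X := fun i => |c i| * X i) (Y := Y) hρ hs (fun i hi => ?_) hy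
  · simpa [mul_assoc] using h
  · rw [abs_mul, mul_assoc]
    exact mul_le_mul_of_nonneg_left (hx i hi) (abs_nonneg _)

/-- A single shifted term: `|c · x (n-1)| ρⁿ = ρ |c| (|x (n-1)| ρ^(n-1))` for `n ≥ 1`. -/
theorem majorant_shift_one {ρ : ℝ} (hρ : 0 ≤ ρ) {n : ℕ} (hn : 1 ≤ n) {x : ℕ → ℝ} {X : ℝ} (c : ℝ)
    (hx : |x (n - 1)| * ρ ^ (n - 1) ≤ X) : |c * x (n - 1)| * ρ ^ n ≤ ρ * |c| * X := by
  have hsplit : ρ ^ n = ρ ^ (n - 1) * ρ := by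
    rw [← pow_succ, Nat.sub_add_cancel hn]
  rw [abs_mul, hsplit]
  have hx0 : 0 ≤ |x (n - 1)| * ρ ^ (n - 1) := mul_nonneg (abs_nonneg _) (pow_nonneg hρ _)
  calc |c| * |x (n - 1)| * (ρ ^ (n - 1) * ρ) = ρ * |c| * (|x (n - 1)| * ρ ^ (n - 1)) := by ring
    _ ≤ ρ * |c| * X := mul_le_mul_of_nonneg_left hx (by positivity)

/-- Two shifts: `|c · x (n-2)| ρⁿ = ρ² |c| (|x (n-2)| ρ^(n-2))` for `n ≥ 2`. -/
theorem majorant_shift_two {ρ : ℝ} (hρ : 0 ≤ ρ) {n : ℕ} (hn : 2 ≤ n) {x : ℕ → ℝ} {X : ℝ} (c : ℝ)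
    (hx : |x (n - 2)| * ρ ^ (n - 2) ≤ X) : |c * x (n - 2)| * ρ ^ n ≤ ρ ^ 2 * |c| * X := by
  have hsplit : ρ ^ n = ρ ^ (n - 2) * ρ ^ 2 := by
    rw [← pow_add, Nat.sub_add_cancel hn]
  rw [abs_mul, hsplit]
  have hx0 : 0 ≤ |x (n - 2)| * ρ ^ (n - 2) := mul_nonneg (abs_nonneg _) (pow_nonneg hρ _)
  calc |c| * |x (n - 2)| * (ρ ^ (n - 2) * ρ ^ 2) = ρ ^ 2 * |c| * (|x (n - 2)| * ρ ^ (n - 2)) := by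
        ring
    _ ≤ ρ ^ 2 * |c| * X := mul_le_mul_of_nonneg_left hx (by positivity)

/-! ### The two-regime weight `ω_λ(m) = 1/(m(2λ−1+m))` -/

/-- `ω_λ(m) > 0` for `m ≥ 1`, `λ ≥ 2`. -/
theorem omegaW_pos {lam : ℝ} (hlam : 2 ≤ lam) {m : ℕ} (hm : 1 ≤ m) :
    0 < 1 / ((m : ℝ) * (2 * lam - 1 + m)) := by
  have h1 : (1 : ℝ) ≤ m := by exact_mod_cast hm
  have h2 : 0 < 2 * lam - 1 + m := by linarith
  exact div_pos one_pos (mul_pos (by linarith) h2)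

/-- `ω_λ(m−1) ≤ 3 ω_λ(m)` for `m ≥ 2` (indeed `≤ 2(2λ+1)/(2λ) ≤ 5/2`). -/
theorem omegaW_pred_le {lam : ℝ} (hlam : 2 ≤ lam) {m : ℕ} (hm : 2 ≤ m) :
    1 / ((((m - 1 : ℕ) : ℝ)) * (2 * lam - 1 + ((m - 1 : ℕ) : ℝ)))
      ≤ 3 * (1 / ((m : ℝ) * (2 * lam - 1 + m))) := by
  have hm1 : ((m - 1 : ℕ) : ℝ) = (m : ℝ) - 1 := by
    rw [Nat.cast_sub (by omega)]; simp
  rw [hm1]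
  have hmr : (2 : ℝ) ≤ m := by exact_mod_cast hm
  have hA : 0 < ((m : ℝ) - 1) * (2 * lam - 1 + ((m : ℝ) - 1)) := by
    apply mul_pos <;> linarith
  have hB : 0 < (m : ℝ) * (2 * lam - 1 + m) := by
    apply mul_pos <;> linarith
  rw [show (3 : ℝ) * (1 / ((m : ℝ) * (2 * lam - 1 + m))) = 3 / ((m : ℝ) * (2 * lam - 1 + m)) by ring,
    div_le_div_iff₀ hA hB]
  nlinarith

/-- `ω_λ(m) ≤ 1/m²`. -/
theorem omegaW_le_inv_sq {lam : ℝ} (hlam : 2 ≤ lam) {m : ℕ} (hm : 1 ≤ m) :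
    1 / ((m : ℝ) * (2 * lam - 1 + m)) ≤ 1 / (m : ℝ) ^ 2 := by
  have hmr : (1 : ℝ) ≤ m := by exact_mod_cast hm
  have hpos : 0 < (m : ℝ) ^ 2 := by positivity
  apply one_div_le_one_div_of_le hpos
  nlinarith

/-- `n · ω_λ(n) = 1/(2λ−1+n) ≤ 1`, in the form `ω_λ(n) ≤ 1/n · 1` … precisely
`1/(n(2λ−1+n)) · n = 1/(2λ−1+n)`. -/
theorem omegaW_mul_self :
    ∀ {lam : ℝ}, 2 ≤ lam → ∀ {n : ℕ}, 1 ≤ n → 1 / ((n : ℝ) * (2 * lam - 1 + n)) * n = 1 / (2 * lam -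
      1 + n) := by
  intro lam hlam n hn
  have hnr : (1 : ℝ) ≤ n := by exact_mod_cast hn
  have h1 : (n : ℝ) ≠ 0 := by positivity
  have h2 : 2 * lam - 1 + n ≠ 0 := by linarith
  field_simp

/-! ### The forcing `α` under the profile hypothesis -/

/-- **`|α_i| ρ^i ≤ 3ρ/i`** for all `i ≥ 1`, if `α 1 = −2`,
`α i = (1−i) G i + 2(i−2) G (i−1)` (`i ≥ 2`) and `|G i| ρ^i ≤ 2ρ/i²` (`i ≥ 2`), `0 ≤ ρ ≤ 1/16384`. -/
theorem alpha_scaled_le {ρ : ℝ} (hρ : 0 ≤ ρ) (hρle : ρ ≤ 1 / 16384) {G α : ℕ → ℝ}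
    (hα1 : α 1 = -2) (hα : ∀ i, 2 ≤ i → α i = (1 - (i : ℝ)) * G i + 2 * ((i : ℝ) - 2) * G (i - 1))
    (hG : ∀ i, 2 ≤ i → |G i| * ρ ^ i ≤ 2 * ρ / (i : ℝ) ^ 2) :
    ∀ i, 1 ≤ i → |α i| * ρ ^ i ≤ 3 * ρ / i := by
  intro i hi
  rcases Nat.lt_or_ge i 2 with hlt | hge
  · obtain rfl : i = 1 := by omega
    rw [hα1]
    norm_num
    linarith
  · rw [hα i hge]
    have hir : (2 : ℝ) ≤ i := by exact_mod_cast hge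
    have hi0 : (0 : ℝ) < i := by linarith
    -- first piece: |(1-i) G i| ρ^i ≤ (i-1) · 2ρ/i²
    have h1 : |(1 - (i : ℝ)) * G i| * ρ ^ i ≤ ((i : ℝ) - 1) * (2 * ρ / (i : ℝ) ^ 2) := by
      rw [abs_mul, show |1 - (i : ℝ)| = (i : ℝ) - 1 by
        rw [abs_sub_comm]; exact abs_of_nonneg (by linarith), mul_assoc]
      exact mul_le_mul_of_nonneg_left (hG i hge) (by linarith)
    -- second piece: |2(i-2) G (i-1)| ρ^i ≤ 2(i-2) ρ · (2ρ/(i-1)²) for i ≥ 3; zero for i = 2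
    have h2 : |2 * ((i : ℝ) - 2) * G (i - 1)| * ρ ^ i ≤ 2 * ((i : ℝ) - 2) * ρ * (2 * ρ / ((i : ℝ) - 1) ^ 2) := by
      rcases Nat.lt_or_ge i 3 with hlt3 | hge3
      · obtain rfl : i = 2 := by omega
        norm_num
      · have hGi := hG (i - 1) (by omega)
        have hcast : (((i - 1 : ℕ) : ℝ)) = (i : ℝ) - 1 := by rw [Nat.cast_sub (by omega)]; simp
        rw [hcast] at hGi
        have hsh := majorant_shift_one hρ (by omega : 1 ≤ i) (2 * ((i : ℝ) - 2)) hGi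
        have habs : |2 * ((i : ℝ) - 2)| = 2 * ((i : ℝ) - 2) := abs_of_nonneg (by linarith)
        rw [habs] at hsh
        calc |2 * ((i : ℝ) - 2) * G (i - 1)| * ρ ^ i
            ≤ ρ * (2 * ((i : ℝ) - 2)) * (2 * ρ / ((i : ℝ) - 1) ^ 2) := hsh
          _ = 2 * ((i : ℝ) - 2) * ρ * (2 * ρ / ((i : ℝ) - 1) ^ 2) := by ring
    -- combine
    have htri : |(1 - (i : ℝ)) * G i + 2 * ((i : ℝ) - 2) * G (i - 1)| * ρ ^ i
        ≤ |(1 - (i : ℝ)) * G i| * ρ ^ i + |2 * ((i : ℝ) - 2) * G (i - 1)| * ρ ^ i := by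
      rw [← add_mul]
      exact mul_le_mul_of_nonneg_right (abs_add_le _ _) (pow_nonneg hρ _)
    refine htri.trans ((add_le_add h1 h2).trans ?_)
    -- (i-1)·2ρ/i² + 4(i-2)ρ²/(i-1)² ≤ 3ρ/i
    have hi1 : (1 : ℝ) ≤ (i : ℝ) - 1 := by linarith
    have key : 2 * ((i : ℝ) - 1) ^ 3 + 4 * ρ * ((i : ℝ) - 2) * (i : ℝ) ^ 2
        ≤ 3 * (i : ℝ) * ((i : ℝ) - 1) ^ 2 := by
      have hρi : 4 * ρ * ((i : ℝ) - 2) * (i : ℝ) ^ 2 ≤ ((i : ℝ) - 2) * (i : ℝ) ^ 2 := by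
        have : 0 ≤ ((i : ℝ) - 2) * (i : ℝ) ^ 2 := by positivity
        nlinarith
      nlinarith
    have lhs_eq : ((i : ℝ) - 1) * (2 * ρ / (i : ℝ) ^ 2) + 2 * ((i : ℝ) - 2) * ρ * (2 * ρ / ((i : ℝ) - 1) ^ 2)
        = ρ * (2 * ((i : ℝ) - 1) ^ 3 + 4 * ρ * ((i : ℝ) - 2) * (i : ℝ) ^ 2)
            / ((i : ℝ) ^ 2 * ((i : ℝ) - 1) ^ 2) := by
      field_simp
      ring
    have rhs_eq : 3 * ρ / (i : ℝ) = ρ * (3 * (i : ℝ) * ((i : ℝ) - 1) ^ 2)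
        / ((i : ℝ) ^ 2 * ((i : ℝ) - 1) ^ 2) := by
      field_simp
    rw [lhs_eq, rhs_eq]
    apply div_le_div_of_nonneg_right _ (by positivity)
    exact mul_le_mul_of_nonneg_left key hρ

end Summit.FinalStateConjecture.FinalStateConjecture.Theorems.CrumPeelingRecessiveTower
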